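import Literature.Analysis.Fourier.SelbergMajorants
import HarnessLib

/-!
# The Fourier transforms of Selberg's majorant and minorant are supported in `[−Δ, Δ]`

Topic `Literature/Analysis/Fourier`. Everything in this file is PROVED (no definitions, no named
facts).

This is the Fourier-side half of Selberg's theorem on the functions `F±` of
`SelbergMajorants.lean` (J. D. Vaaler, *Some extremal functions in Fourier analysis*, Bull. AMS
12 (1985), Thm. 8: "`F̂±(t) = 0` for `|t| ≥ Δ`"; Balazard–de Roton, arXiv:0810.3587, Prop. 10
(iii): "`F̂±` est réelle et paire, `F̂±(x) = 0` pour `|x| ≥ Δ` et `|x F̂±(x)| ≤ 2`"), with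
Mathlib's normalisation `𝓕 f(ξ) = ∫ f(x) e^{−2πixξ} dx` (the one used by Balazard–de Roton).

* `Literature.Analysis.Fourier.fourier_eq_zero_of_exponential_type` — **the easy half of the
  Paley–Wiener theorem**, in the form needed here: an entire `F` with
  `|F(z)| ≤ K e^{2πΔ|Im z|} ρ(Re z)`, `ρ` integrable and tending to `0` at `±∞`, has
  `𝓕(F|_ℝ)(ξ) = 0` for `|ξ| > Δ` — by Cauchy's theorem on the rectangles `[−R,R] × [−Y,0]`
  (Mathlib's `Complex.integral_boundary_rect_eq_zero_of_differentiableOn`), `R → ∞`, then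
  `Y → ∞`; and for `|ξ| ≥ Δ` by continuity of `𝓕`.
* `fourier_selbergMajorant_eq_zero`, `fourier_selbergMinorant_eq_zero` — (iii) for `F±`;
  `fourier_selbergMajorant_zero` (`𝓕F₊(0) = (b − a) + 1/Δ`), `fourier_selbergMinorant_zero`;
  `norm_mul_fourier_selbergMajorant_le` (`|ξ| · |𝓕F±(ξ)| ≤ 2`); and for the symmetric interval
  `[−h, h]`: `fourier_selbergMajorant_symm_im` (`𝓕F±(ξ)` is real) and
  `fourier_selbergMajorant_symm_neg` (even).

## References

* [Vaaler1985] J. D. Vaaler, Bull. AMS 12 (1985), Thm. 8 and Thm. 6 (Paley–Wiener input).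
  [cite: Vaaler1985, Thm. 8]
* [BalazardDeRoton2008] M. Balazard, A. de Roton, arXiv:0810.3587, Prop. 10 (iii).
-/

noncomputable section

open Complex Filter Topology Set MeasureTheory Metric intervalIntegral

open scoped Real FourierTransform

namespace Literature.Analysis.Fourier

/-! ## The easy half of Paley–Wiener for functions of exponential type -/

/-- `|e^{−2πiξz}| = e^{2πξ Im z}`. [folklore] -/
lemma norm_cexp_twist (ξ : ℝ) (z : ℂ) :
    ‖Complex.exp (-2 * π * I * ξ * z)‖ = Real.exp (2 * π * ξ * z.im) := by
  rw [Complex.norm_exp]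
  congr 1
  simp [Complex.mul_re, Complex.mul_im]

/-- **Horizontal contour shift.** If `G` is entire, `x ↦ G(x + iy)` is dominated by an integrable
`g` for `−Y ≤ y ≤ 0`, and `G(±R + iy) → 0` uniformly as `R → ∞` for these `y`, then
`∫ G(x − iY) dx = ∫ G(x) dx`. [folklore] -/
theorem integral_horizontal_shift_eq {G : ℂ → ℂ} {g : ℝ → ℝ} {Y : ℝ} (hY : 0 ≤ Y)
    (hG : Differentiable ℂ G) (hg : Integrable g)
    (hdom : ∀ x y : ℝ, -Y ≤ y → y ≤ 0 → ‖G (x + y * I)‖ ≤ g x)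
    (hright : ∀ ε > 0, ∃ R₀ : ℝ, ∀ R : ℝ, R₀ ≤ R → ∀ y : ℝ, -Y ≤ y → y ≤ 0 →
      ‖G ((R : ℂ) + y * I)‖ ≤ ε)
    (hleft : ∀ ε > 0, ∃ R₀ : ℝ, ∀ R : ℝ, R₀ ≤ R → ∀ y : ℝ, -Y ≤ y → y ≤ 0 →
      ‖G (-(R : ℂ) + y * I)‖ ≤ ε) :
    ∫ x : ℝ, G (x + (-Y : ℝ) * I) = ∫ x : ℝ, G x := by
  -- integrability on the two horizontal lines
  have hcont : ∀ y : ℝ, Continuous fun x : ℝ ↦ G (x + y * I) := fun y ↦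
    hG.continuous.comp (by fun_prop)
  have hint : ∀ y : ℝ, -Y ≤ y → y ≤ 0 → Integrable fun x : ℝ ↦ G (x + y * I) := fun y h1 h2 ↦
    Integrable.mono' hg (hcont y).aestronglyMeasurable (Eventually.of_forall fun x ↦ hdom x y h1 h2)
  have hintY := hint (-Y) (le_refl _) (by linarith)
  have hint0 : Integrable fun x : ℝ ↦ G x := by
    have := hint 0 (by linarith) le_rfl
    simpa using this
  -- the rectangle identity
  have hrect : ∀ R : ℝ, (∫ x in -R..R, G (x + (-Y : ℝ) * I)) - (∫ x in -R..R, G (x + (0 : ℝ) * I)) +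
      I • (∫ y in -Y..(0 : ℝ), G ((R : ℂ) + y * I)) -
      I • (∫ y in -Y..(0 : ℝ), G (((-R : ℝ) : ℂ) + y * I)) = 0 := by
    intro R
    have h := Complex.integral_boundary_rect_eq_zero_of_differentiableOn G ⟨-R, -Y⟩ ⟨R, 0⟩
      hG.differentiableOn
    simpa using h
  -- limits as `R → ∞`
  have hA : Tendsto (fun R : ℝ ↦ ∫ x in -R..R, G (x + (-Y : ℝ) * I)) atTop
      (𝓝 (∫ x : ℝ, G (x + (-Y : ℝ) * I))) :=
    intervalIntegral_tendsto_integral hintY tendsto_neg_atTop_atBot tendsto_id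
  have hB : Tendsto (fun R : ℝ ↦ ∫ x in -R..R, G (x + (0 : ℝ) * I)) atTop (𝓝 (∫ x : ℝ, G x)) := by
    have h := intervalIntegral_tendsto_integral hint0 tendsto_neg_atTop_atBot tendsto_id
    refine (h.congr fun R ↦ ?_)
    simp
  have hvert : ∀ s : ℝ, (s = 1 ∨ s = -1) →
      Tendsto (fun R : ℝ ↦ ∫ y in -Y..(0 : ℝ), G (((s * R : ℝ)) + y * I)) atTop (𝓝 0) := by
    intro s hs
    rw [Metric.tendsto_nhds]
    intro ε hε
    have hε' : 0 < ε / (Y + 1) := by positivity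
    obtain ⟨R₀, hR₀⟩ : ∃ R₀ : ℝ, ∀ R : ℝ, R₀ ≤ R → ∀ y : ℝ, -Y ≤ y → y ≤ 0 →
        ‖G (((s * R : ℝ)) + y * I)‖ ≤ ε / (Y + 1) := by
      rcases hs with rfl | rfl
      · obtain ⟨R₀, h⟩ := hright _ hε'
        exact ⟨R₀, fun R hR y h1 h2 ↦ by simpa using h R hR y h1 h2⟩
      · obtain ⟨R₀, h⟩ := hleft _ hε'
        exact ⟨R₀, fun R hR y h1 h2 ↦ by simpa using h R hR y h1 h2⟩
    filter_upwards [eventually_ge_atTop R₀] with R hR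
    rw [dist_zero_right]
    have hb : ‖∫ y in -Y..(0 : ℝ), G (((s * R : ℝ)) + y * I)‖ ≤ ε / (Y + 1) * |0 - -Y| := by
      refine intervalIntegral.norm_integral_le_of_norm_le_const fun y hy ↦ ?_
      rw [uIoc_of_le (by linarith)] at hy
      exact hR₀ R hR y hy.1.le hy.2
    calc ‖∫ y in -Y..(0 : ℝ), G (((s * R : ℝ)) + y * I)‖ ≤ ε / (Y + 1) * |0 - -Y| := hb
      _ = ε * (Y / (Y + 1)) := by rw [sub_neg_eq_add, zero_add, abs_of_nonneg hY]; ring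
      _ < ε * 1 := by
          apply mul_lt_mul_of_pos_left _ hε
          rw [div_lt_one (by linarith)]; linarith
      _ = ε := mul_one ε
  have hV : Tendsto (fun R : ℝ ↦ ∫ y in -Y..(0 : ℝ), G ((R : ℂ) + y * I)) atTop (𝓝 0) := by
    have := hvert 1 (Or.inl rfl)
    refine this.congr fun R ↦ ?_
    simp
  have hW : Tendsto (fun R : ℝ ↦ ∫ y in -Y..(0 : ℝ), G (((-R : ℝ) : ℂ) + y * I)) atTop (𝓝 0) := by
    have := hvert (-1) (Or.inr rfl)
    refine this.congr fun R ↦ ?_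
    simp
  have hlim : Tendsto (fun R : ℝ ↦ (∫ x in -R..R, G (x + (-Y : ℝ) * I)) -
      (∫ x in -R..R, G (x + (0 : ℝ) * I)) + I • (∫ y in -Y..(0 : ℝ), G ((R : ℂ) + y * I)) -
      I • (∫ y in -Y..(0 : ℝ), G (((-R : ℝ) : ℂ) + y * I))) atTop
      (𝓝 ((∫ x : ℝ, G (x + (-Y : ℝ) * I)) - (∫ x : ℝ, G x) + I • (0 : ℂ) - I • (0 : ℂ))) :=
    ((hA.sub hB).add (hV.const_smul I)).sub (hW.const_smul I)
  have hzero : Tendsto (fun R : ℝ ↦ (∫ x in -R..R, G (x + (-Y : ℝ) * I)) -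
      (∫ x in -R..R, G (x + (0 : ℝ) * I)) + I • (∫ y in -Y..(0 : ℝ), G ((R : ℂ) + y * I)) -
      I • (∫ y in -Y..(0 : ℝ), G (((-R : ℝ) : ℂ) + y * I))) atTop (𝓝 0) := by
    simp_rw [hrect]
    exact tendsto_const_nhds
  have heq := tendsto_nhds_unique hlim hzero
  simp only [smul_zero, add_zero, sub_zero] at heq
  exact sub_eq_zero.1 heq

/-- **Paley–Wiener, easy half (right side).** Let `F` be entire with
`|F(z)| ≤ K e^{2πΔ|Im z|} ρ(Re z)` where `ρ ≥ 0` is integrable and tends to `0` at `±∞`. Then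
`∫ F(x) e^{−2πiξx} dx = 0` for every `ξ > Δ`. [cite: Vaaler1985, Thm. 6 and Thm. 8] -/
theorem integral_mul_cexp_eq_zero_of_exponential_type {F : ℂ → ℂ} {Δ K : ℝ} {ρ : ℝ → ℝ}
    (hF : Differentiable ℂ F) (hK : 0 ≤ K) (hρ0 : ∀ x, 0 ≤ ρ x) (hρi : Integrable ρ)
    (hρtop : Tendsto ρ atTop (𝓝 0)) (hρbot : Tendsto ρ atBot (𝓝 0))
    (hb : ∀ z : ℂ, ‖F z‖ ≤ K * Real.exp (2 * π * Δ * |z.im|) * ρ z.re) {ξ : ℝ} (hξ : Δ < ξ) :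
    ∫ x : ℝ, F x * Complex.exp (-2 * π * I * ξ * x) = 0 := by
  set G : ℂ → ℂ := fun z ↦ F z * Complex.exp (-2 * π * I * ξ * z) with hGdef
  have hG : Differentiable ℂ G := hF.mul (by fun_prop)
  -- the key pointwise bound in the closed lower half-plane
  have hGb : ∀ x y : ℝ, y ≤ 0 → ‖G (x + y * I)‖ ≤ K * ρ x * Real.exp (2 * π * (ξ - Δ) * y) := by
    intro x y hy
    have h1 := hb (x + y * I)
    have him : (x + y * I : ℂ).im = y := by simp
    have hre : (x + y * I : ℂ).re = x := by simp
    rw [him, hre, abs_of_nonpos hy] at h1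
    rw [hGdef]
    simp only
    rw [norm_mul, norm_cexp_twist, him]
    calc ‖F (x + y * I)‖ * Real.exp (2 * π * ξ * y)
        ≤ K * Real.exp (2 * π * Δ * -y) * ρ x * Real.exp (2 * π * ξ * y) := by gcongr
      _ = K * ρ x * (Real.exp (2 * π * Δ * -y) * Real.exp (2 * π * ξ * y)) := by ring
      _ = K * ρ x * Real.exp (2 * π * (ξ - Δ) * y) := by rw [← Real.exp_add]; ring_nf
  have hGb' : ∀ x y : ℝ, y ≤ 0 → ‖G (x + y * I)‖ ≤ K * ρ x := by
    intro x y hy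
    refine (hGb x y hy).trans ?_
    have : Real.exp (2 * π * (ξ - Δ) * y) ≤ 1 := by
      rw [Real.exp_le_one_iff]
      have : 0 ≤ 2 * π * (ξ - Δ) := by nlinarith [Real.pi_pos]
      nlinarith
    calc K * ρ x * Real.exp (2 * π * (ξ - Δ) * y) ≤ K * ρ x * 1 := by
          gcongr
          exact mul_nonneg hK (hρ0 x)
      _ = K * ρ x := mul_one _
  -- Step 1–2: the shift to depth `−Y`
  have hshift : ∀ Y : ℝ, 0 ≤ Y → ∫ x : ℝ, G (x + (-Y : ℝ) * I) = ∫ x : ℝ, G x := by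
    intro Y hY
    refine integral_horizontal_shift_eq hY hG (hρi.const_mul K) (fun x y _ h2 ↦ hGb' x y h2) ?_ ?_
    · intro ε hε
      have hev : ∀ᶠ R in atTop, K * ρ R < ε := by
        have : Tendsto (fun R ↦ K * ρ R) atTop (𝓝 (K * 0)) := hρtop.const_mul K
        rw [mul_zero] at this
        exact (tendsto_order.1 this).2 ε hε
      obtain ⟨R₀, hR₀⟩ := hev.exists_forall_of_atTop
      exact ⟨R₀, fun R hR y _ h2 ↦ (hGb' R y h2).trans (hR₀ R hR).le⟩
    · intro ε hε
      have hev : ∀ᶠ R in atTop, K * ρ (-R) < ε := by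
        have : Tendsto (fun R : ℝ ↦ K * ρ (-R)) atTop (𝓝 (K * 0)) :=
          (hρbot.comp tendsto_neg_atTop_atBot).const_mul K
        rw [mul_zero] at this
        exact (tendsto_order.1 this).2 ε hε
      obtain ⟨R₀, hR₀⟩ := hev.exists_forall_of_atTop
      refine ⟨R₀, fun R hR y _ h2 ↦ ?_⟩
      have := hGb' (-R) y h2
      rw [Complex.ofReal_neg] at this
      exact this.trans (hR₀ R hR).le
  -- Step 3: the shifted integral is exponentially small in `Y`
  have hsmall : ∀ Y : ℝ, 0 ≤ Y →
      ‖∫ x : ℝ, G x‖ ≤ K * (∫ x, ρ x) * Real.exp (-(2 * π * (ξ - Δ) * Y)) := by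
    intro Y hY
    rw [← hshift Y hY]
    calc ‖∫ x : ℝ, G (x + (-Y : ℝ) * I)‖ ≤ ∫ x : ℝ, ‖G (x + (-Y : ℝ) * I)‖ :=
          norm_integral_le_integral_norm _
      _ ≤ ∫ x : ℝ, K * ρ x * Real.exp (2 * π * (ξ - Δ) * (-Y)) := by
          refine integral_mono_of_nonneg (Eventually.of_forall fun x ↦ norm_nonneg _)
            ((hρi.const_mul K).mul_const _) (Eventually.of_forall fun x ↦ ?_)
          have := hGb x (-Y) (by linarith)
          rw [Complex.ofReal_neg] at this ⊢
          exact this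
      _ = K * (∫ x, ρ x) * Real.exp (-(2 * π * (ξ - Δ) * Y)) := by
          rw [MeasureTheory.integral_mul_const, MeasureTheory.integral_const_mul]; ring_nf
  have hlim : Tendsto (fun Y : ℝ ↦ K * (∫ x, ρ x) * Real.exp (-(2 * π * (ξ - Δ) * Y))) atTop
      (𝓝 (K * (∫ x, ρ x) * 0)) := by
    refine tendsto_const_nhds.mul ?_
    refine Real.tendsto_exp_atBot.comp ?_
    have hc : 0 < 2 * π * (ξ - Δ) := by nlinarith [Real.pi_pos]
    have : Tendsto (fun Y : ℝ ↦ 2 * π * (ξ - Δ) * Y) atTop atTop :=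
      Tendsto.const_mul_atTop hc tendsto_id
    simpa using this  -- `tendsto_neg_atTop_atBot.comp`
  rw [mul_zero] at hlim
  have hle : ‖∫ x : ℝ, G x‖ ≤ 0 :=
    ge_of_tendsto hlim ((eventually_ge_atTop 0).mono fun Y hY ↦ hsmall Y hY)
  have h0 : ∫ x : ℝ, G x = 0 := norm_le_zero_iff.1 hle
  simpa [hGdef] using h0

/-- The Fourier transform of the restriction to `ℝ` of `F`, as our twisted integral. [folklore] -/
lemma fourier_restrict_eq (F : ℂ → ℂ) (ξ : ℝ) :
    𝓕 (fun x : ℝ ↦ F x) ξ = ∫ x : ℝ, F x * Complex.exp (-2 * π * I * ξ * x) := by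
  rw [Real.fourier_real_eq_integral_exp_smul]
  refine integral_congr_ae (Eventually.of_forall fun x ↦ ?_)
  simp only [smul_eq_mul]
  rw [mul_comm]
  congr 1
  push_cast
  ring_nf

/-- **Paley–Wiener, easy half**: under the hypotheses of
`integral_mul_cexp_eq_zero_of_exponential_type`, `𝓕(F|_ℝ)(ξ) = 0` for all `|ξ| > Δ`.
[cite: Vaaler1985, Thm. 6 and Thm. 8] -/
theorem fourier_eq_zero_of_exponential_type {F : ℂ → ℂ} {Δ K : ℝ} {ρ : ℝ → ℝ}
    (hF : Differentiable ℂ F) (hK : 0 ≤ K) (hρ0 : ∀ x, 0 ≤ ρ x) (hρi : Integrable ρ)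
    (hρtop : Tendsto ρ atTop (𝓝 0)) (hρbot : Tendsto ρ atBot (𝓝 0))
    (hb : ∀ z : ℂ, ‖F z‖ ≤ K * Real.exp (2 * π * Δ * |z.im|) * ρ z.re) {ξ : ℝ} (hξ : Δ < |ξ|) :
    𝓕 (fun x : ℝ ↦ F x) ξ = 0 := by
  rcases le_or_gt 0 ξ with h0 | h0
  · rw [abs_of_nonneg h0] at hξ
    rw [fourier_restrict_eq]
    exact integral_mul_cexp_eq_zero_of_exponential_type hF hK hρ0 hρi hρtop hρbot hb hξ
  · rw [abs_of_neg h0] at hξ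
    -- reflect: `𝓕 f ξ = 𝓕 (f ∘ neg) (−ξ)`
    have hrefl : 𝓕 (fun x : ℝ ↦ F x) ξ = 𝓕 (fun x : ℝ ↦ F (-x)) (-ξ) := by
      have h1 := Real.fourierInv_eq_fourier_neg (fun x : ℝ ↦ F x) (-ξ)
      rw [neg_neg] at h1
      rw [← h1, Real.fourierInv_eq_fourier_comp_neg]
      simp
    rw [hrefl]
    have h3 := fourier_restrict_eq (fun z : ℂ ↦ F (-z)) (-ξ)
    have h4 := integral_mul_cexp_eq_zero_of_exponential_type (F := fun z : ℂ ↦ F (-z))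
      (ρ := fun x ↦ ρ (-x)) (hF.comp differentiable_neg) hK (fun x ↦ hρ0 _) hρi.comp_neg
      (hρbot.comp tendsto_neg_atTop_atBot) (hρtop.comp tendsto_neg_atBot_atTop)
      (fun z ↦ by simpa using hb (-z)) hξ
    beta_reduce at h3 h4
    rw [h3, h4]

/-- Continuity of the Fourier transform of an integrable function on `ℝ`. [folklore] -/
private lemma continuous_fourier_aux {f : ℝ → ℂ} (hf : Integrable f) : Continuous (𝓕 f) :=
  VectorFourier.fourierIntegral_continuous Real.continuous_fourierChar continuous_inner hf

/-- Closing the gap at `|ξ| = Δ` by continuity. [folklore] -/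
theorem fourier_eq_zero_of_exponential_type' {F : ℂ → ℂ} {Δ K : ℝ} {ρ : ℝ → ℝ}
    (hF : Differentiable ℂ F) (hK : 0 ≤ K) (hρ0 : ∀ x, 0 ≤ ρ x) (hρi : Integrable ρ)
    (hρtop : Tendsto ρ atTop (𝓝 0)) (hρbot : Tendsto ρ atBot (𝓝 0))
    (hb : ∀ z : ℂ, ‖F z‖ ≤ K * Real.exp (2 * π * Δ * |z.im|) * ρ z.re)
    (hint : Integrable fun x : ℝ ↦ F x) {ξ : ℝ} (hξ : Δ ≤ |ξ|) (hΔ : 0 ≤ Δ) :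
    𝓕 (fun x : ℝ ↦ F x) ξ = 0 := by
  rcases hξ.lt_or_eq with hlt | heq
  · exact fourier_eq_zero_of_exponential_type hF hK hρ0 hρi hρtop hρbot hb hlt
  · -- `|ξ| = Δ`: approach from outside
    have hc := continuous_fourier_aux hint
    have key : ∀ s : ℝ, (s = 1 ∨ s = -1) → 𝓕 (fun x : ℝ ↦ F x) (s * Δ) = 0 := by
      intro s hs
      have ht : Tendsto (fun n : ℕ ↦ s * (Δ + 1 / ((n : ℝ) + 1))) atTop (𝓝 (s * (Δ + 0))) :=
        tendsto_const_nhds.mul (tendsto_const_nhds.add tendsto_one_div_add_atTop_nhds_zero_nat)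
      rw [add_zero] at ht
      have h1 := (hc.tendsto _).comp ht
      have h2 : Tendsto ((𝓕 fun x : ℝ ↦ F x) ∘ fun n : ℕ ↦ s * (Δ + 1 / ((n : ℝ) + 1))) atTop (𝓝 0) := by
        have : ((𝓕 fun x : ℝ ↦ F x) ∘ fun n : ℕ ↦ s * (Δ + 1 / ((n : ℝ) + 1))) = fun _ ↦ 0 := by
          funext n
          simp only [Function.comp_apply]
          apply fourier_eq_zero_of_exponential_type hF hK hρ0 hρi hρtop hρbot hb
          have hpos : 0 < 1 / ((n : ℝ) + 1) := by positivity
          rcases hs with rfl | rfl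
          · rw [one_mul, abs_of_pos (by linarith)]; linarith
          · rw [neg_one_mul, abs_neg, abs_of_pos (by linarith)]; linarith
        rw [this]; exact tendsto_const_nhds
      exact tendsto_nhds_unique h1 h2
    rcases le_or_gt 0 ξ with h0 | h0
    · rw [abs_of_nonneg h0] at heq
      have := key 1 (Or.inl rfl)
      rwa [one_mul, heq] at this
    · rw [abs_of_neg h0] at heq
      have := key (-1) (Or.inr rfl)
      rwa [neg_one_mul, heq, neg_neg] at this

/-! ## Application to Selberg's functions -/

/-- The integrable, decaying profile `ρ(x) = (1+(x−a)²)⁻¹ + (1+(x−b)²)⁻¹`. [folklore] -/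
lemma profile_props (a b : ℝ) :
    (∀ x : ℝ, 0 ≤ (1 + (x - a) ^ 2)⁻¹ + (1 + (x - b) ^ 2)⁻¹) ∧
    Integrable (fun x : ℝ ↦ (1 + (x - a) ^ 2)⁻¹ + (1 + (x - b) ^ 2)⁻¹) ∧
    Tendsto (fun x : ℝ ↦ (1 + (x - a) ^ 2)⁻¹ + (1 + (x - b) ^ 2)⁻¹) atTop (𝓝 0) ∧
    Tendsto (fun x : ℝ ↦ (1 + (x - a) ^ 2)⁻¹ + (1 + (x - b) ^ 2)⁻¹) atBot (𝓝 0) := by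
  refine ⟨fun x ↦ by positivity, ?_, ?_, ?_⟩
  · exact (integrable_inv_one_add_sq.comp_sub_right a).add (integrable_inv_one_add_sq.comp_sub_right b)
  · have h : ∀ c : ℝ, Tendsto (fun x : ℝ ↦ (1 + (x - c) ^ 2)⁻¹) atTop (𝓝 0) := by
      intro c
      refine tendsto_inv_atTop_zero.comp ?_
      refine tendsto_atTop_add_const_left _ _ ?_
      exact (tendsto_pow_atTop two_ne_zero).comp (tendsto_atTop_add_const_right _ _ tendsto_id)
    simpa using (h a).add (h b)
  · have h : ∀ c : ℝ, Tendsto (fun x : ℝ ↦ (1 + (x - c) ^ 2)⁻¹) atBot (𝓝 0) := by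
      intro c
      refine tendsto_inv_atTop_zero.comp ?_
      refine tendsto_atTop_add_const_left _ _ ?_
      have : Tendsto (fun x : ℝ ↦ (x - c) ^ 2) atBot atTop := by
        have h2 : Tendsto (fun x : ℝ ↦ x - c) atBot atBot := tendsto_atBot_add_const_right _ _ tendsto_id
        exact (tendsto_pow_atTop two_ne_zero).comp (tendsto_neg_atBot_atTop.comp h2) |>.congr
          (fun x ↦ by simp only [Function.comp_apply]; ring)
      exact this
    simpa using (h a).add (h b)

/-- `F₊` restricted to `ℝ` is integrable (as a complex-valued function). [folklore] -/
lemma integrable_selbergMajorant_ofReal {Δ a b : ℝ} (hΔ : 0 < Δ) (hab : a ≤ b) :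
    Integrable fun x : ℝ ↦ selbergMajorant Δ a b x := by
  have h := (integrable_selbergMajorantReal hΔ hab).ofReal (𝕜 := ℂ)
  refine h.congr (Eventually.of_forall fun x ↦ ?_)
  simp [selbergMajorant_ofReal]

/-- `F₋` restricted to `ℝ` is integrable (as a complex-valued function). [folklore] -/
lemma integrable_selbergMinorant_ofReal {Δ a b : ℝ} (hΔ : 0 < Δ) (hab : a ≤ b) :
    Integrable fun x : ℝ ↦ selbergMinorant Δ a b x := by
  have h := (integrable_selbergMinorantReal hΔ hab).ofReal (𝕜 := ℂ)
  refine h.congr (Eventually.of_forall fun x ↦ ?_)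
  simp [selbergMinorant_ofReal]

/-- **Prop. 10 (iii) for `F₊`: `𝓕F₊(ξ) = 0` for `|ξ| ≥ Δ`.**
[cite: Vaaler1985, Thm. 8; BalazardDeRoton2008, Prop. 10 (iii)] -/
theorem fourier_selbergMajorant_eq_zero {Δ a b : ℝ} (hΔ : 0 < Δ) (hab : a ≤ b) {ξ : ℝ}
    (hξ : Δ ≤ |ξ|) : 𝓕 (fun x : ℝ ↦ selbergMajorant Δ a b x) ξ = 0 := by
  obtain ⟨K, hK, hb⟩ := exists_norm_selbergMajorant_le hΔ a b
  obtain ⟨h0, hi, htop, hbot⟩ := profile_props a b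
  exact fourier_eq_zero_of_exponential_type' (differentiable_selbergMajorant Δ a b) hK.le h0 hi htop
    hbot hb (integrable_selbergMajorant_ofReal hΔ hab) hξ hΔ.le

/-- **Prop. 10 (iii) for `F₋`: `𝓕F₋(ξ) = 0` for `|ξ| ≥ Δ`.**
[cite: Vaaler1985, Thm. 8; BalazardDeRoton2008, Prop. 10 (iii)] -/
theorem fourier_selbergMinorant_eq_zero {Δ a b : ℝ} (hΔ : 0 < Δ) (hab : a ≤ b) {ξ : ℝ}
    (hξ : Δ ≤ |ξ|) : 𝓕 (fun x : ℝ ↦ selbergMinorant Δ a b x) ξ = 0 := by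
  obtain ⟨K, hK, hb⟩ := exists_norm_selbergMinorant_le hΔ a b
  obtain ⟨h0, hi, htop, hbot⟩ := profile_props a b
  exact fourier_eq_zero_of_exponential_type' (differentiable_selbergMinorant Δ a b) hK.le h0 hi htop
    hbot hb (integrable_selbergMinorant_ofReal hΔ hab) hξ hΔ.le

/-- **`𝓕F₊(0) = (b − a) + 1/Δ`** (Prop. 10 (ii): `F̂₊(0) = 2h + 1/Δ` for `[−h, h]`).
[cite: Vaaler1985, Thm. 8; BalazardDeRoton2008, Prop. 10 (ii)] -/
theorem fourier_selbergMajorant_zero {Δ a b : ℝ} (hΔ : 0 < Δ) (hab : a ≤ b) :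
    𝓕 (fun x : ℝ ↦ selbergMajorant Δ a b x) 0 = ((b - a) + 1 / Δ : ℝ) := by
  rw [Real.fourier_real_eq_integral_exp_smul]
  simp only [mul_zero, Complex.ofReal_zero, zero_mul, Complex.exp_zero, one_smul]
  simp_rw [selbergMajorant_ofReal]
  rw [integral_complex_ofReal, integral_selbergMajorantReal hΔ hab]

/-- **`𝓕F₋(0) = (b − a) − 1/Δ`.** [cite: Vaaler1985, Thm. 8; BalazardDeRoton2008, Prop. 10 (ii)] -/
theorem fourier_selbergMinorant_zero {Δ a b : ℝ} (hΔ : 0 < Δ) (hab : a ≤ b) :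
    𝓕 (fun x : ℝ ↦ selbergMinorant Δ a b x) 0 = ((b - a) - 1 / Δ : ℝ) := by
  rw [Real.fourier_real_eq_integral_exp_smul]
  simp only [mul_zero, Complex.ofReal_zero, zero_mul, Complex.exp_zero, one_smul]
  simp_rw [selbergMinorant_ofReal]
  rw [integral_complex_ofReal, integral_selbergMinorantReal hΔ hab]

/-! ## Evenness and reality of `𝓕F±` for a symmetric interval -/

/-- The Fourier transform of an even function is even. [folklore] -/
theorem fourier_neg_of_even {f : ℝ → ℂ} (hf : ∀ x, f (-x) = f x) (ξ : ℝ) :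
    𝓕 f (-ξ) = 𝓕 f ξ := by
  rw [← Real.fourierInv_eq_fourier_neg, Real.fourierInv_eq_fourier_comp_neg]
  have : (fun x : ℝ ↦ f (-x)) = f := funext hf
  rw [this]

/-- For a real-valued `f`: `conj (𝓕f(ξ)) = 𝓕f(−ξ)`. [folklore] -/
theorem conj_fourier_ofReal (f : ℝ → ℝ) (ξ : ℝ) :
    (starRingEnd ℂ) (𝓕 (fun x : ℝ ↦ (f x : ℂ)) ξ) = 𝓕 (fun x : ℝ ↦ (f x : ℂ)) (-ξ) := by
  rw [Real.fourier_real_eq_integral_exp_smul, Real.fourier_real_eq_integral_exp_smul, ← integral_conj]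
  refine integral_congr_ae (Eventually.of_forall fun v ↦ ?_)
  simp only [smul_eq_mul, map_mul, Complex.conj_ofReal, ← Complex.exp_conj, Complex.conj_I,
    Complex.conj_ofReal]
  congr 2
  push_cast
  ring

/-- The Fourier transform of a real even function is real. [folklore] -/
theorem fourier_im_eq_zero_of_real_even {f : ℝ → ℝ} (hf : ∀ x, f (-x) = f x) (ξ : ℝ) :
    (𝓕 (fun x : ℝ ↦ (f x : ℂ)) ξ).im = 0 := by
  have h1 := conj_fourier_ofReal f ξ
  rw [fourier_neg_of_even (f := fun x : ℝ ↦ (f x : ℂ)) (fun x ↦ by simp [hf x]) ξ] at h1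
  exact Complex.conj_eq_iff_im.1 h1

/-- **`𝓕F₊` is real and even for `[−h, h]`** (Prop. 10 (iii), first clause).
[cite: BalazardDeRoton2008, Prop. 10 (iii)] -/
theorem fourier_selbergMajorant_symm_neg (Δ h ξ : ℝ) :
    𝓕 (fun x : ℝ ↦ selbergMajorant Δ (-h) h x) (-ξ) = 𝓕 (fun x : ℝ ↦ selbergMajorant Δ (-h) h x) ξ :=
  fourier_neg_of_even (fun x ↦ by
    have := selbergMajorant_symm_neg Δ h x
    push_cast at this ⊢
    exact this) ξ

/-- `𝓕F₊(ξ)` is real for `[−h, h]`. [cite: BalazardDeRoton2008, Prop. 10 (iii)] -/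
theorem fourier_selbergMajorant_symm_im (Δ h ξ : ℝ) :
    (𝓕 (fun x : ℝ ↦ selbergMajorant Δ (-h) h x) ξ).im = 0 := by
  have heq : (fun x : ℝ ↦ selbergMajorant Δ (-h) h x) = fun x : ℝ ↦ (selbergMajorantReal Δ (-h) h x : ℂ) := by
    funext x; exact selbergMajorant_ofReal Δ (-h) h x
  rw [heq]
  exact fourier_im_eq_zero_of_real_even (fun x ↦ selbergMajorantReal_symm_neg Δ h x) ξ

/-- **`𝓕F₋` is real and even for `[−h, h]`.** [cite: BalazardDeRoton2008, Prop. 10 (iii)] -/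
theorem fourier_selbergMinorant_symm_neg (Δ h ξ : ℝ) :
    𝓕 (fun x : ℝ ↦ selbergMinorant Δ (-h) h x) (-ξ) = 𝓕 (fun x : ℝ ↦ selbergMinorant Δ (-h) h x) ξ :=
  fourier_neg_of_even (fun x ↦ by
    have := selbergMinorant_symm_neg Δ h x
    push_cast at this ⊢
    exact this) ξ

/-- `𝓕F₋(ξ)` is real for `[−h, h]`. [cite: BalazardDeRoton2008, Prop. 10 (iii)] -/
theorem fourier_selbergMinorant_symm_im (Δ h ξ : ℝ) :
    (𝓕 (fun x : ℝ ↦ selbergMinorant Δ (-h) h x) ξ).im = 0 := by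
  have heq : (fun x : ℝ ↦ selbergMinorant Δ (-h) h x) = fun x : ℝ ↦ (selbergMinorantReal Δ (-h) h x : ℂ) := by
    funext x; exact selbergMinorant_ofReal Δ (-h) h x
  rw [heq]
  exact fourier_im_eq_zero_of_real_even (fun x ↦ selbergMinorantReal_symm_neg Δ h x) ξ

/-! ## The bound `|ξ · 𝓕F±(ξ)| ≤ 2` -/

/-- The Fourier transform of the indicator of `[a,b]`: `|ξ| · |𝓕𝟙_{[a,b]}(ξ)| ≤ 1/π`. [folklore] -/
theorem abs_mul_norm_fourier_indicator_le {a b : ℝ} (hab : a ≤ b) (ξ : ℝ) :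
    |ξ| * ‖𝓕 (fun x : ℝ ↦ (((Icc a b).indicator (fun _ ↦ (1 : ℝ)) x : ℝ) : ℂ)) ξ‖ ≤ 1 / π := by
  rcases eq_or_ne ξ 0 with rfl | hξ
  · simp; positivity
  set c : ℂ := -2 * π * ξ * I with hc
  have hc0 : c ≠ 0 := by
    rw [hc]; simp [Real.pi_ne_zero, hξ, Complex.I_ne_zero]
  have hnc : ‖c‖ = 2 * π * |ξ| := by
    rw [hc]; simp [abs_of_pos Real.pi_pos]
  -- compute the transform
  have hF : 𝓕 (fun x : ℝ ↦ (((Icc a b).indicator (fun _ ↦ (1 : ℝ)) x : ℝ) : ℂ)) ξ =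
      (Complex.exp (c * b) - Complex.exp (c * a)) / c := by
    rw [Real.fourier_real_eq_integral_exp_smul]
    have h1 : (fun v : ℝ ↦ Complex.exp (↑(-2 * π * v * ξ) * I) • (((Icc a b).indicator (fun _ ↦ (1 : ℝ)) v : ℝ) : ℂ)) =
        (Icc a b).indicator (fun v : ℝ ↦ Complex.exp (c * v)) := by
      funext v
      by_cases hv : v ∈ Icc a b
      · rw [indicator_of_mem hv, indicator_of_mem hv]
        simp only [Complex.ofReal_one, smul_eq_mul, mul_one]
        congr 1; rw [hc]; push_cast; ring
      · rw [indicator_of_notMem hv, indicator_of_notMem hv]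
        simp
    rw [h1, MeasureTheory.integral_indicator measurableSet_Icc, integral_Icc_eq_integral_Ioc,
      ← intervalIntegral.integral_of_le hab, integral_exp_mul_complex hc0]
  rw [hF, norm_div, hnc]
  have hnum : ‖Complex.exp (c * b) - Complex.exp (c * a)‖ ≤ 2 := by
    have h1 : ‖Complex.exp (c * b)‖ = 1 := by
      rw [Complex.norm_exp]; simp [hc]
    have h2 : ‖Complex.exp (c * a)‖ = 1 := by
      rw [Complex.norm_exp]; simp [hc]
    calc ‖Complex.exp (c * b) - Complex.exp (c * a)‖ ≤ ‖Complex.exp (c * b)‖ + ‖Complex.exp (c * a)‖ :=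
          norm_sub_le _ _
      _ = 2 := by rw [h1, h2]; norm_num
  have hξ0 : 0 < |ξ| := abs_pos.2 hξ
  calc |ξ| * (‖Complex.exp (c * b) - Complex.exp (c * a)‖ / (2 * π * |ξ|))
      = ‖Complex.exp (c * b) - Complex.exp (c * a)‖ / (2 * π) := by
        field_simp
    _ ≤ 2 / (2 * π) := by gcongr
    _ = 1 / π := by ring

/-- `F₊ − 𝟙_{[a,b]}` has Fourier transform of norm at most `1/Δ` everywhere (its `L¹` norm).
[cite: Vaaler1985, Thm. 8] -/
theorem norm_fourier_selbergMajorant_sub_indicator_le {Δ a b : ℝ} (hΔ : 0 < Δ) (hab : a ≤ b) (ξ : ℝ) :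
    ‖𝓕 (fun x : ℝ ↦ ((selbergMajorantReal Δ a b x - (Icc a b).indicator (fun _ ↦ (1 : ℝ)) x : ℝ) : ℂ)) ξ‖
      ≤ 1 / Δ := by
  refine (VectorFourier.norm_fourierIntegral_le_integral_norm _ _ _ _ _).trans ?_
  rw [← integral_selbergMajorantReal_sub_indicator hΔ hab]
  refine le_of_eq (integral_congr_ae (Eventually.of_forall fun x ↦ ?_))
  simp only [Complex.norm_real, Real.norm_eq_abs]
  rw [abs_of_nonneg]
  linarith [indicator_le_selbergMajorantReal hΔ hab x]

/-- `𝟙_{[a,b]} − F₋` has Fourier transform of norm at most `1/Δ`. [cite: Vaaler1985, Thm. 8] -/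
theorem norm_fourier_indicator_sub_selbergMinorant_le {Δ a b : ℝ} (hΔ : 0 < Δ) (hab : a ≤ b) (ξ : ℝ) :
    ‖𝓕 (fun x : ℝ ↦ (((Icc a b).indicator (fun _ ↦ (1 : ℝ)) x - selbergMinorantReal Δ a b x : ℝ) : ℂ)) ξ‖
      ≤ 1 / Δ := by
  refine (VectorFourier.norm_fourierIntegral_le_integral_norm _ _ _ _ _).trans ?_
  rw [← integral_indicator_sub_selbergMinorantReal hΔ hab]
  refine le_of_eq (integral_congr_ae (Eventually.of_forall fun x ↦ ?_))
  simp only [Complex.norm_real, Real.norm_eq_abs]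
  rw [abs_of_nonneg]
  linarith [selbergMinorantReal_le_indicator_Icc hΔ a b x]

/-- Additivity of `𝓕` on `ℝ` for integrable functions (pointwise). [folklore] -/
lemma fourier_add_apply {f g : ℝ → ℂ} (hf : Integrable f) (hg : Integrable g) (ξ : ℝ) :
    𝓕 (fun x ↦ f x + g x) ξ = 𝓕 f ξ + 𝓕 g ξ := by
  have h := VectorFourier.fourierIntegral_add (e := Real.fourierChar) (μ := volume) (L := innerₗ ℝ)
    Real.continuous_fourierChar continuous_inner hf hg
  exact congrFun h ξ

/-- **`|ξ| · |𝓕F₊(ξ)| ≤ 2`** (Prop. 10 (iii), last clause). [cite: BalazardDeRoton2008, Prop. 10 (iii)] -/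
theorem abs_mul_norm_fourier_selbergMajorant_le {Δ a b : ℝ} (hΔ : 0 < Δ) (hab : a ≤ b) (ξ : ℝ) :
    |ξ| * ‖𝓕 (fun x : ℝ ↦ selbergMajorant Δ a b x) ξ‖ ≤ 2 := by
  rcases le_or_gt Δ |ξ| with hfar | hnear
  · rw [fourier_selbergMajorant_eq_zero hΔ hab hfar, norm_zero, mul_zero]; norm_num
  · set u : ℝ → ℂ := fun x ↦ (((selbergMajorantReal Δ a b x - (Icc a b).indicator (fun _ ↦ (1 : ℝ)) x : ℝ) : ℂ)) with hu
    set v : ℝ → ℂ := fun x ↦ (((Icc a b).indicator (fun _ ↦ (1 : ℝ)) x : ℝ) : ℂ) with hv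
    have hsplit : (fun x : ℝ ↦ selbergMajorant Δ a b x) = fun x : ℝ ↦ u x + v x := by
      funext x; rw [selbergMajorant_ofReal, hu, hv]; push_cast; ring
    have hiu : Integrable u := (integrable_selbergMajorantReal_sub_indicator hΔ hab).ofReal (𝕜 := ℂ)
    have hiv : Integrable v := (integrable_indicator_Icc a b).ofReal (𝕜 := ℂ)
    rw [hsplit, fourier_add_apply hiu hiv]
    have h1 : |ξ| * ‖𝓕 u ξ‖ ≤ Δ * (1 / Δ) := by
      gcongr
      exact norm_fourier_selbergMajorant_sub_indicator_le hΔ hab ξ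
    have h2 : |ξ| * ‖𝓕 v ξ‖ ≤ 1 / π := abs_mul_norm_fourier_indicator_le hab ξ
    have hπ : 1 / π ≤ 1 := by rw [div_le_one Real.pi_pos]; linarith [Real.pi_gt_three]
    calc |ξ| * ‖𝓕 u ξ + 𝓕 v ξ‖ ≤ |ξ| * (‖𝓕 u ξ‖ + ‖𝓕 v ξ‖) := by gcongr; exact norm_add_le _ _
      _ = |ξ| * ‖𝓕 u ξ‖ + |ξ| * ‖𝓕 v ξ‖ := by ring
      _ ≤ Δ * (1 / Δ) + 1 / π := add_le_add h1 h2
      _ ≤ 2 := by rw [mul_one_div_cancel hΔ.ne']; linarith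

/-- **`|ξ| · |𝓕F₋(ξ)| ≤ 2`.** [cite: BalazardDeRoton2008, Prop. 10 (iii)] -/
theorem abs_mul_norm_fourier_selbergMinorant_le {Δ a b : ℝ} (hΔ : 0 < Δ) (hab : a ≤ b) (ξ : ℝ) :
    |ξ| * ‖𝓕 (fun x : ℝ ↦ selbergMinorant Δ a b x) ξ‖ ≤ 2 := by
  rcases le_or_gt Δ |ξ| with hfar | hnear
  · rw [fourier_selbergMinorant_eq_zero hΔ hab hfar, norm_zero, mul_zero]; norm_num
  · set u : ℝ → ℂ := fun x ↦ -((((Icc a b).indicator (fun _ ↦ (1 : ℝ)) x - selbergMinorantReal Δ a b x : ℝ) : ℂ)) with hu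
    set v : ℝ → ℂ := fun x ↦ (((Icc a b).indicator (fun _ ↦ (1 : ℝ)) x : ℝ) : ℂ) with hv
    have hsplit : (fun x : ℝ ↦ selbergMinorant Δ a b x) = fun x : ℝ ↦ u x + v x := by
      funext x; rw [selbergMinorant_ofReal, hu, hv]; push_cast; ring
    have hiu : Integrable u := ((integrable_indicator_sub_selbergMinorantReal hΔ hab).ofReal (𝕜 := ℂ)).neg
    have hiv : Integrable v := (integrable_indicator_Icc a b).ofReal (𝕜 := ℂ)
    rw [hsplit, fourier_add_apply hiu hiv]
    have hneg : 𝓕 u ξ = -𝓕 (fun x : ℝ ↦ ((((Icc a b).indicator (fun _ ↦ (1 : ℝ)) x - selbergMinorantReal Δ a b x : ℝ) : ℂ))) ξ := by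
      rw [hu]
      simp only [Real.fourier_real_eq_integral_exp_smul, smul_neg, MeasureTheory.integral_neg]
    have h1 : |ξ| * ‖𝓕 u ξ‖ ≤ Δ * (1 / Δ) := by
      rw [hneg, norm_neg]
      gcongr
      exact norm_fourier_indicator_sub_selbergMinorant_le hΔ hab ξ
    have h2 : |ξ| * ‖𝓕 v ξ‖ ≤ 1 / π := abs_mul_norm_fourier_indicator_le hab ξ
    have hπ : 1 / π ≤ 1 := by rw [div_le_one Real.pi_pos]; linarith [Real.pi_gt_three]
    calc |ξ| * ‖𝓕 u ξ + 𝓕 v ξ‖ ≤ |ξ| * (‖𝓕 u ξ‖ + ‖𝓕 v ξ‖) := by gcongr; exact norm_add_le _ _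
      _ = |ξ| * ‖𝓕 u ξ‖ + |ξ| * ‖𝓕 v ξ‖ := by ring
      _ ≤ Δ * (1 / Δ) + 1 / π := add_le_add h1 h2
      _ ≤ 2 := by rw [mul_one_div_cancel hΔ.ne']; linarith

end Literature.Analysis.Fourier
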